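import Summits.QuantumFields.BalabanUV.Beta.RemainderExplicitHistoryDiagonalEchoMonotone

/-!
# RemainderExplicitHistoryDiagonalTwoStepMonotone — ROAD P3, ORDER-0 PROFILE FAMILY: EXACT MONOTONICITY OF THE MATCHED DISCREPANCY IN THE
# POSITION FOR TWO-STEP MEMORY, AT EVERY POSITION — for two infrared-pinned runs (A: `K` steps, B: `K + n` steps) of
# `β_{k+1} = b + ρ(1)·min(g_k, |g_k − g_{k−1}|) + ρ(2)·min(g_k, |g_k − g_{k−2}|)` with `ρ(2) ≤ ρ(1)`, `ρ(1) + ρ(2) ≤ W`, `Wγ ≤ b` (the family's own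
# smallness) the matched discrepancy `d_j = 1∕(g^B_{j+n})² − 1∕(g^A_j)²` is NON-INCREASING in the position `j` on the WHOLE run: census item (i′)
# of generations 50–53 SETTLED for two-step memory (position `0`: B's extra-age source; position `1`: the window identity at `1` + the cube +
# ultraviolet suppression, NO monotonicity of the profile needed; positions `j ≥ 2`: the echo count of the first file); family read-out: along
# every run the continuum correction `astar g m − invSq g m (K−m)` grows towards the ultraviolet end (station S-d4p3-g54-1, second file)

Cell `pub-balaban`, β-function sub-cell, BINDER row D4 «RemainderConst leaves for Bałaban's split» (`HOME/BINDER-OWNERS.md`; owner lineage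
`b2b-balaban-beta-an4`; this file by co-owner #3 lineage `b2b-balaban-beta-d4-p3`, road P3 «the reduction road», generation 54, station
S-d4p3-g54-1, second file; imports the first file `RemainderExplicitHistoryDiagonalEchoMonotone`), β-FLOW TEAM duty (1); FREEZE (0) honoured
(def-free module in road P3's own `RemainderExplicit*` series; no leaf, no interface, no Literature file).  SOURCE OF THE SHAPES ONLY:
[Balaban1987RG1] (0.20) p. 256, (0.31) and Thm 2 p. 259, §5 p. 298.  [folklore] real analysis about ONE explicit toy family (ours), road P3's
ORDER-0 PROFILE FAMILY (generation 44).
HONEST FRAMING: *"Discharging BetaPertH makes Bałaban's UV stability UNCONDITIONAL — a real constructive-QFT result; it is NOT the continuum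
limit and NOT the Clay problem."*  THIS FILE DISCHARGES NOTHING OF THE KIND; nothing of Bałaban's (1.22) is asserted or constructed; row D4
class UNCHANGED (critical-path width 0; instance 0∕1; D4 DISCHARGE NO DATE); NOT B12 Thm 2, NOT BetaPertH, NOT continuum, NOT Clay.  HONEST
DEPENDENCY: continuum YM on T⁴ ⇐ BetaPertH ∧ nine spine estimates (0/9 proved); BetaPertH ⇐ (D1) ∧ (D4) ∧ CAP+tail; G-an2-4 gates asym, D1
and NE2/3/4.  ABSOLUTE RULE: nothing is cited as a fact.  All letters NOT-IN-PRINT; `BetaFlowAsPrinted S` records a Markov β_n only.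

THE ARGUMENT AT POSITION `1` (the only memory-zone position of two-step memory).  `d_1 − d_2 = E_1 + ρ(1)(e_0 − e_1)` (generation 49's step
identity; `E_1 ≥ 0` B's age-`2` extra source, `e_i = g^A_i − g^B_{i+n} ≥ 0`); the window identity of generation 49 at the position `1` gives
`d_1 ≤ E_1 + (ρ(1)+ρ(2))e_0 + ρ(2)e_1` (`disc_one_le_twoStep`: beyond position `1` only the age-`2` weights of `e_0, e_1` are positive, the pin's
window is dropped); with `e_1 ≤ ((g^A_1)³∕2)·d_1` (generation 49's `gap_le_cube_mul`) and `W(g^A_1)³ ≤ Wγ∕b ≤ 1` (the first file's ultraviolet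
suppression `(g_1)³(K−1) ≤ γ∕b`): `ρ(1)e_1 ≤ E_1 + ρ(1)e_0`, i.e. `d_2 ≤ d_1` — for ANY `ρ(1), ρ(2) ≥ 0`.  The profile's monotonicity `ρ(2) ≤ ρ(1)`
enters only beyond the memory (`j ≥ 2`, first file), where generation 50's two-age profiles (`ρ(1) = 0 < ρ(2)`) are NOT monotone.

WHAT IS PROVED ([folklore]; 0 sorry; 0 `def`).  §1 **`disc_one_le_disc_zero`** (`d_1 ≤ d_0`, ANY profile).  §2 `disc_one_le_twoStep`,
**`disc_two_le_disc_one_twoStep`** (`d_2 ≤ d_1`, any `ρ(1), ρ(2) ≥ 0`, `Wγ ≤ b`).  §3 **`disc_succ_le_disc_twoStep`** (`d_{j+1} ≤ d_j` for every `j < K`,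
`ρ(2) ≤ ρ(1)`, `Wγ ≤ b`), `windowAverage_twoStep` (`0 ≤ E_j + Σ_{i≤j} ρ(j−i)(e_i − e_j)`: the current gap is below the profile-average of its
window plus B's bonus).  §4 PINNED FAMILY: **`invSq_shift_mono_position_twoStep`**, **`astar_sub_invSq_mono_position_twoStep`**
(`astar g m − invSq g m (j+1) ≤ astar g (m+1) − invSq g (m+1) j`, all `m, j`), `astar_sub_invSq_mono_position_twoStep_le`.
-/

noncomputable section

open Finset Filter Topology

namespace Summit.QuantumFields.BalabanUV.Beta.RemainderExplicitHistoryDiagonalTwoStepMonotone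

open Literature.MathematicalPhysics.QuantumFieldTheory.Balaban1983to89
open Literature.MathematicalPhysics.QuantumFieldTheory.Balaban1983to89.FlowStep
open Literature.MathematicalPhysics.QuantumFieldTheory.Balaban1983to89.T4CouplingMatching
open Literature.MathematicalPhysics.QuantumFieldTheory.Balaban1983to89.T4ContinuumCoupling
open Summit.QuantumFields.BalabanUV.Beta.RemainderExplicitHistoryDiagonalMonotone
open Summit.QuantumFields.BalabanUV.Beta.RemainderExplicitHistoryDiagonalWeights
open Summit.QuantumFields.BalabanUV.Beta.RemainderExplicitHistoryDiagonalTwoRun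
open Summit.QuantumFields.BalabanUV.Beta.RemainderExplicitHistoryDiagonalWindow
open Summit.QuantumFields.BalabanUV.Beta.RemainderExplicitHistoryDiagonalOneStepMonotone
open Summit.QuantumFields.BalabanUV.Beta.RemainderExplicitHistoryDiagonalEchoMonotone

variable {β : HBeta} {b γ W : ℝ} {ρ : ℕ → ℝ}

/-! ## §1 The first position: the decrement is B's extra-age source (any profile) -/

/-- **THE FIRST DECREMENT IS NONNEGATIVE FOR EVERY PROFILE.**  Two runs of road P3's order-0 profile family (`b > 0`, `ρ ≥ 0`; A: `K ≥ 1`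
steps, B: `K + n` steps, positive couplings): `d_1 ≤ d_0`, `d_j = 1∕(g^B_{j+n})² − 1∕(g^A_j)²` — at the ultraviolet end run A has no history, so
`d_0 − d_1` is B's extra-age source `E_0 ≥ 0` (generation 53's `disc_step_zero`, `extra_nonneg`). [cite: Balaban1987RG1, (0.20) p.256] -/
theorem disc_one_le_disc_zero
    (hβ : ∀ (k : ℕ) (p : Fin (k + 1) → ℝ),
      β k p = b + ∑ i : Fin (k + 1), ρ (k - i) * min (p (Fin.last k)) (|p (Fin.last k) - p i|))
    (hb : 0 < b) (hρ0 : ∀ a, 0 ≤ ρ a) {K n : ℕ} {gA gB : ℕ → ℝ} (hA : RGEqH K β gA) (hB : RGEqH (K + n) β gB)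
    (hApos : ∀ k, k ≤ K → 0 < gA k) (hBpos : ∀ k, k ≤ K + n → 0 < gB k) (hK : 0 < K) :
    1 / (gB (1 + n)) ^ 2 - 1 / (gA 1) ^ 2 ≤ 1 / (gB n) ^ 2 - 1 / (gA 0) ^ 2 := by
  have h0 := disc_step_zero hβ hb hρ0 hA hB hApos hBpos hK
  have hE := extra_nonneg hβ hb hρ0 hB hBpos (j := 0) (Nat.zero_le K)
  simp only [Nat.zero_add] at h0 hE
  linarith

/-! ## §2 The second position for two-step memory -/

/-- THE DISCREPANCY AT POSITION `1`, TWO-STEP MEMORY (`ρ(a) = 0` for `a ≥ 3`; two pinned runs): with `e_i = g^A_i − g^B_{i+n}` and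
B's extra-age source `E_1 = Σ_{i<n} ρ(1+n−i)(g^B_{1+n} − g^B_i)` (`K ≥ 2`),
`d_1 ≤ E_1 + (ρ(1) + ρ(2))·e_0 + ρ(2)·e_1` — generation 49's window identity at the position `1`: beyond it only the age-`2` weight of `e_0`, `e_1`
survives with a positive sign (the pin's window enters with a negative sign and is dropped). [cite: Balaban1987RG1, (0.20) p.256 and Thm 2 p.259] -/
theorem disc_one_le_twoStep
    (hβ : ∀ (k : ℕ) (p : Fin (k + 1) → ℝ),
      β k p = b + ∑ i : Fin (k + 1), ρ (k - i) * min (p (Fin.last k)) (|p (Fin.last k) - p i|))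
    (hb : 0 < b) (hρ0 : ∀ a, 0 ≤ ρ a) (hρ2 : ∀ a, 3 ≤ a → ρ a = 0) {K n : ℕ} {gA gB : ℕ → ℝ} (hA : RGEqH K β gA)
    (hB : RGEqH (K + n) β gB) (hApos : ∀ k, k ≤ K → 0 < gA k) (hBpos : ∀ k, k ≤ K + n → 0 < gB k) (hpin : gA K = gB (K + n))
    (hK : 1 < K) :
    1 / (gB (1 + n)) ^ 2 - 1 / (gA 1) ^ 2
      ≤ (∑ i ∈ range n, ρ (1 + n - i) * (gB (1 + n) - gB i))
        + (ρ 1 + ρ 2) * (gA 0 - gB n) + ρ 2 * (gA 1 - gB (1 + n)) := by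
  have hdom := invSq_le_invSq_shift_run hβ hb hρ0 hA hB hApos hBpos hpin
  have he : ∀ i, i ≤ K → 0 ≤ gA i - gB (i + n) := fun i hi => by
    linarith [le_of_one_div_sq_le (hApos i hi) (hBpos (i + n) (by omega)) (hdom i hi)]
  have hsupp : ∀ a, 2 < a → ρ a = 0 := fun a ha => hρ2 a (by omega)
  rw [window_identity hβ hb hρ0 hA hB hApos hBpos hpin hK.le]
  -- the extra sources beyond position 1 vanish
  have hE : ∑ j ∈ Ico 1 K, ∑ i ∈ range n, ρ (j + n - i) * (gB (j + n) - gB i)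
      = ∑ i ∈ range n, ρ (1 + n - i) * (gB (1 + n) - gB i) := by
    rw [Finset.sum_eq_single_of_mem 1 (Finset.mem_Ico.mpr ⟨le_rfl, by omega⟩)]
    intro j hj hj1
    have hj' := Finset.mem_Ico.mp hj
    refine Finset.sum_eq_zero fun i hi => ?_
    have hi' := Finset.mem_range.mp hi
    rw [hρ2 (j + n - i) (by omega), zero_mul]
  -- the ultraviolet gap `e_0` feeds through the ages `1, 2` only
  have hR3 : ∑ a ∈ range 3, ρ a = ρ 0 + ρ 1 + ρ 2 := by
    simp [Finset.sum_range_succ]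
  have hV : ∑ i ∈ range 1, (gA i - gB (i + n)) * (∑ a ∈ range (K - i), ρ a - ∑ a ∈ range (1 - i), ρ a)
      ≤ (ρ 1 + ρ 2) * (gA 0 - gB n) := by
    rw [Finset.sum_range_one, Nat.sub_zero, Nat.sub_zero, Finset.sum_range_one, Nat.zero_add]
    have h3 : ∑ a ∈ range K, ρ a ≤ ∑ a ∈ range 3, ρ a := partialSum_le_of_support hρ0 hsupp (by norm_num) K
    have := he 0 (by omega)
    rw [Nat.zero_add] at this
    nlinarith
  -- in the window only `e_1` can receive a positive weight (`ρ(2)`); every other position exerts at most its self-weight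
  have hX : ∑ i ∈ Ico 1 K, (gA i - gB (i + n)) * (∑ a ∈ range (K - i), ρ a - ∑ a ∈ range (i + 1), ρ a)
      ≤ ρ 2 * (gA 1 - gB (1 + n)) := by
    rw [Finset.sum_eq_sum_Ico_succ_bot hK]
    -- the position `1`: weight `R(K−1) − R(2) ≤ R(3) − R(2) = ρ(2)`
    have h1 : (gA 1 - gB (1 + n)) * (∑ a ∈ range (K - 1), ρ a - ∑ a ∈ range (1 + 1), ρ a)
        ≤ ρ 2 * (gA 1 - gB (1 + n)) := by
      have h3 : ∑ a ∈ range (K - 1), ρ a ≤ ∑ a ∈ range 3, ρ a := partialSum_le_of_support hρ0 hsupp (by norm_num) (K - 1)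
      have h2 : ∑ a ∈ range (1 + 1), ρ a = ρ 0 + ρ 1 := by simp [Finset.sum_range_succ]
      rw [h2]
      have := he 1 hK.le
      nlinarith
    -- the positions `i ≥ 2`: saturated self-weight
    have hrest : ∑ i ∈ Ico (1 + 1) K, (gA i - gB (i + n)) * (∑ a ∈ range (K - i), ρ a - ∑ a ∈ range (i + 1), ρ a) ≤ 0 := by
      refine Finset.sum_nonpos fun i hi => ?_
      have hi' := Finset.mem_Ico.mp hi
      have hR : ∑ a ∈ range (K - i), ρ a ≤ ∑ a ∈ range (i + 1), ρ a :=
        partialSum_le_of_support hρ0 hsupp (by omega) (K - i)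
      exact mul_nonpos_of_nonneg_of_nonpos (he i hi'.2.le) (by linarith)
    linarith
  linarith

/-- **THE SECOND DECREMENT IS NONNEGATIVE, TWO-STEP MEMORY** (`ρ(a) = 0` for `a ≥ 3`, ANY `ρ(1), ρ(2) ≥ 0` with `Σ_{a<N} ρ(a) ≤ W`,
`Wγ ≤ b`; two runs in ]0,γ] — A: `K ≥ 2` steps, B: `K + n` steps — pinned): `d_2 ≤ d_1`.  PROOF: `d_1 − d_2 = E_1 + ρ(1)(e_0 − e_1)` (generation 49's
step identity), `e_1 ≤ ((g^A_1)³∕2)·d_1` (`…Weights.gap_le_cube_mul`), `d_1 ≤ E_1 + (ρ(1)+ρ(2))e_0 + ρ(2)e_1` (`disc_one_le_twoStep`) and the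
ultraviolet suppression `W(g^A_1)³ ≤ Wγ∕b ≤ 1` (`…EchoMonotone.cube_mul_dist_le`), so `ρ(1)e_1 ≤ E_1 + ρ(1)e_0`.  No monotonicity of the profile
is needed at this position. [cite: Balaban1987RG1, (0.20) p.256, (0.31) and Thm 2 p.259] -/
theorem disc_two_le_disc_one_twoStep
    (hβ : ∀ (k : ℕ) (p : Fin (k + 1) → ℝ),
      β k p = b + ∑ i : Fin (k + 1), ρ (k - i) * min (p (Fin.last k)) (|p (Fin.last k) - p i|))
    (hb : 0 < b) (hρ0 : ∀ a, 0 ≤ ρ a) (hρW : ∀ n, ∑ a ∈ range n, ρ a ≤ W) (hρ2 : ∀ a, 3 ≤ a → ρ a = 0) (hWγ : W * γ ≤ b)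
    {K n : ℕ} {gA gB : ℕ → ℝ} (hA : RGEqH K β gA) (hB : RGEqH (K + n) β gB) (hAbox : ∀ k, k ≤ K → 0 < gA k ∧ gA k ≤ γ)
    (hBpos : ∀ k, k ≤ K + n → 0 < gB k) (hpin : gA K = gB (K + n)) (hK : 1 < K) :
    1 / (gB (2 + n)) ^ 2 - 1 / (gA 2) ^ 2 ≤ 1 / (gB (1 + n)) ^ 2 - 1 / (gA 1) ^ 2 := by
  have hApos : ∀ k, k ≤ K → 0 < gA k := fun k hk => (hAbox k hk).1
  have hdom := invSq_le_invSq_shift_run hβ hb hρ0 hA hB hApos hBpos hpin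
  have he : ∀ i, i ≤ K → 0 ≤ gA i - gB (i + n) := fun i hi => by
    linarith [le_of_one_div_sq_le (hApos i hi) (hBpos (i + n) (by omega)) (hdom i hi)]
  -- names
  set E1 : ℝ := ∑ i ∈ range n, ρ (1 + n - i) * (gB (1 + n) - gB i) with hE1_def
  set e0 : ℝ := gA 0 - gB n with he0_def
  set e1 : ℝ := gA 1 - gB (1 + n) with he1_def
  set d1 : ℝ := 1 / (gB (1 + n)) ^ 2 - 1 / (gA 1) ^ 2 with hd1_def
  set q : ℝ := (gA 1) ^ 3 / 2 with hq_def
  have hE1 : 0 ≤ E1 := by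
    have := extra_nonneg hβ hb hρ0 hB hBpos (j := 1) hK.le
    simpa [hE1_def] using this
  have he0 : 0 ≤ e0 := by have := he 0 (by omega); simpa [he0_def] using this
  have he1 : 0 ≤ e1 := he 1 hK.le
  have hq : 0 ≤ q := by rw [hq_def]; exact div_nonneg (pow_nonneg (hApos 1 hK.le).le 3) (by norm_num)
  -- the step identity at position 1
  have hstep : d1 - (1 / (gB (2 + n)) ^ 2 - 1 / (gA 2) ^ 2) = E1 + ρ 1 * e0 - ρ 1 * e1 := by
    have h := disc_step_window hβ hb hρ0 hA hB hApos hBpos hK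
    rw [show (1 + 1 + n) = 2 + n by omega] at h
    rw [h]
    simp only [Finset.sum_range_succ, Finset.sum_range_zero, hE1_def, he0_def, he1_def, Nat.sub_zero, Nat.sub_self,
      zero_add]
    ring
  -- the three inequalities
  have hgap : e1 ≤ q * d1 := by
    have := gap_le_cube_mul (hBpos (1 + n) (by omega)) (le_of_one_div_sq_le (hApos 1 hK.le) (hBpos (1 + n) (by omega)) (hdom 1 hK.le))
    simpa [he1_def, hq_def, hd1_def] using this
  have hd1 : d1 ≤ E1 + (ρ 1 + ρ 2) * e0 + ρ 2 * e1 := disc_one_le_twoStep hβ hb hρ0 hρ2 hA hB hApos hBpos hpin hK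
  have hW : 0 ≤ W := by simpa using hρW 0
  have huv : W * (gA 1) ^ 3 ≤ 1 := by
    have h := cube_mul_dist_le hβ hb hρ0 hA hAbox hK.le
    have hK1 : (1 : ℝ) ≤ ((K - 1 : ℕ) : ℝ) := by exact_mod_cast (show 1 ≤ K - 1 by omega)
    have hg3 : 0 ≤ (gA 1) ^ 3 := pow_nonneg (hApos 1 hK.le).le 3
    have h0 : (gA 1) ^ 3 ≤ (gA 1) ^ 3 * ((K - 1 : ℕ) : ℝ) := by nlinarith
    have h1 : (gA 1) ^ 3 ≤ γ / b := h0.trans h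
    calc W * (gA 1) ^ 3 ≤ W * (γ / b) := mul_le_mul_of_nonneg_left h1 hW
      _ = W * γ / b := by ring
      _ ≤ 1 := by rw [div_le_one hb]; exact hWγ
  -- weights against `W`
  have hρ12W : ρ 1 + ρ 2 ≤ W := by
    have h := hρW 3
    simp only [Finset.sum_range_succ, Finset.sum_range_zero, zero_add] at h
    linarith [hρ0 0]
  have hρ1W : ρ 1 ≤ W := by linarith [hρ0 2]
  have hρ2W : ρ 2 ≤ W := by linarith [hρ0 1]
  have hqW : q * W ≤ 1 / 2 := by
    have : q * W = W * (gA 1) ^ 3 / 2 := by rw [hq_def]; ring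
    rw [this]; linarith
  -- `e_1 ≤ q·d_1 ≤ q·(E_1 + (ρ1+ρ2) e_0 + ρ2 e_1)` and `qρ2 ≤ 1∕2` give `e_1 ≤ 2q E_1 + 2q (ρ1+ρ2) e_0`
  have h1 : e1 ≤ q * E1 + q * (ρ 1 + ρ 2) * e0 + q * ρ 2 * e1 := by
    have h := hgap.trans (mul_le_mul_of_nonneg_left hd1 hq)
    have e : q * (E1 + (ρ 1 + ρ 2) * e0 + ρ 2 * e1) = q * E1 + q * (ρ 1 + ρ 2) * e0 + q * ρ 2 * e1 := by ring
    linarith [h, e.le, e.ge]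
  have hqρ2 : q * ρ 2 ≤ 1 / 2 := (mul_le_mul_of_nonneg_left hρ2W hq).trans hqW
  have hprod : q * ρ 2 * e1 ≤ 1 / 2 * e1 := mul_le_mul_of_nonneg_right hqρ2 he1
  have h2 : e1 ≤ 2 * q * E1 + 2 * q * (ρ 1 + ρ 2) * e0 := by linarith
  -- multiply by `ρ(1)` and use `2qρ1 ≤ 1`, `2q(ρ1+ρ2) ≤ 1`
  have h3a : ρ 1 * e1 ≤ ρ 1 * (2 * q * E1 + 2 * q * (ρ 1 + ρ 2) * e0) := mul_le_mul_of_nonneg_left h2 (hρ0 1)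
  have h3b : ρ 1 * (2 * q * E1 + 2 * q * (ρ 1 + ρ 2) * e0) = (2 * (q * ρ 1)) * E1 + (2 * (q * (ρ 1 + ρ 2))) * (ρ 1 * e0) := by ring
  have hb1 : 2 * (q * ρ 1) ≤ 1 := by linarith [(mul_le_mul_of_nonneg_left hρ1W hq).trans hqW]
  have hb2 : 2 * (q * (ρ 1 + ρ 2)) ≤ 1 := by linarith [(mul_le_mul_of_nonneg_left hρ12W hq).trans hqW]
  have hc1 : (2 * (q * ρ 1)) * E1 ≤ 1 * E1 := mul_le_mul_of_nonneg_right hb1 hE1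
  have hc2 : (2 * (q * (ρ 1 + ρ 2))) * (ρ 1 * e0) ≤ 1 * (ρ 1 * e0) := mul_le_mul_of_nonneg_right hb2 (mul_nonneg (hρ0 1) he0)
  have h3 : ρ 1 * e1 ≤ E1 + ρ 1 * e0 := by linarith [h3a, h3b.le, h3b.ge, hc1, hc2]
  linarith [hstep, h3]

/-! ## §3 Two-step memory: exact monotonicity in the position everywhere -/

/-- **EXACT MONOTONICITY IN THE POSITION, TWO-STEP MEMORY.**  Road P3's order-0 profile family in ]0,γ] with a profile supported on the ages
`1, 2` (`ρ(a) = 0` for `a ≥ 3`) and `ρ(2) ≤ ρ(1)`, `Σ_{a<N} ρ(a) ≤ W`, `Wγ ≤ b` (the family's own smallness); two runs — A: `K` steps, B: `K + n`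
steps — pinned `g^A_K = g^B_{K+n}`.  THEN for every `j < K`: `1∕(g^B_{j+1+n})² − 1∕(g^A_{j+1})² ≤ 1∕(g^B_{j+n})² − 1∕(g^A_j)²` — census item (i′)
of generations 50–53 SETTLED for two-step memory: position `0` by `disc_one_le_disc_zero`, position `1` by `disc_two_le_disc_one_twoStep`,
positions `j ≥ 2` (beyond the memory) by the echo count `…EchoMonotone.disc_succ_le_disc_of_memory_le`.  Generation 50's two-age
counterexamples have `ρ(2) > ρ(1) = 0`. [cite: Balaban1987RG1, (0.20) p.256, (0.31) and Thm 2 p.259] -/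
theorem disc_succ_le_disc_twoStep
    (hβ : ∀ (k : ℕ) (p : Fin (k + 1) → ℝ),
      β k p = b + ∑ i : Fin (k + 1), ρ (k - i) * min (p (Fin.last k)) (|p (Fin.last k) - p i|))
    (hb : 0 < b) (hρ0 : ∀ a, 0 ≤ ρ a) (hρW : ∀ n, ∑ a ∈ range n, ρ a ≤ W) (hρ2 : ∀ a, 3 ≤ a → ρ a = 0) (hρ12 : ρ 2 ≤ ρ 1)
    (hWγ : W * γ ≤ b) {K n : ℕ} {gA gB : ℕ → ℝ} (hA : RGEqH K β gA) (hB : RGEqH (K + n) β gB)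
    (hAbox : ∀ k, k ≤ K → 0 < gA k ∧ gA k ≤ γ) (hBpos : ∀ k, k ≤ K + n → 0 < gB k) (hpin : gA K = gB (K + n)) :
    ∀ j, j < K → 1 / (gB (j + 1 + n)) ^ 2 - 1 / (gA (j + 1)) ^ 2 ≤ 1 / (gB (j + n)) ^ 2 - 1 / (gA j) ^ 2 := by
  have hApos : ∀ k, k ≤ K → 0 < gA k := fun k hk => (hAbox k hk).1
  have hmono : ∀ a, 1 ≤ a → ρ (a + 1) ≤ ρ a := by
    intro a ha
    rcases Nat.lt_or_ge a 2 with h2 | h2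
    · have : a = 1 := by omega
      subst this; exact hρ12
    · rw [hρ2 (a + 1) (by omega)]; exact hρ0 a
  have hWγ2 : W * γ ≤ 2 * b := by linarith
  intro j hj
  rcases Nat.lt_or_ge j 2 with hj2 | hj2
  · rcases Nat.lt_or_ge j 1 with hj1 | hj1
    · have hj0 : j = 0 := by omega
      subst hj0
      have h := disc_one_le_disc_zero hβ hb hρ0 hA hB hApos hBpos hj
      simpa [Nat.add_comm] using h
    · have hj1' : j = 1 := by omega
      subst hj1'
      have h := disc_two_le_disc_one_twoStep hβ hb hρ0 hρW hρ2 hWγ hA hB hAbox hBpos hpin hj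
      simpa using h
  · exact disc_succ_le_disc_of_memory_le hβ hb hρ0 hρW hmono hWγ2 (A := 2) (fun a ha => hρ2 a (by omega)) hA hB hAbox hBpos hpin
      hj2 hj

/-- **THE COUPLING GAPS' WINDOW SUMS ARE SUB-AVERAGED, TWO-STEP MEMORY**: same hypotheses; for every `j < K`,
`(ρ(1) + ρ(2))·e_j ≤ E_j + ρ(1)e_{j−1} + ρ(2)e_{j−2}` in the form `0 ≤ d_j − d_{j+1} = E_j + Σ_{i≤j} ρ(j−i)(e_i − e_j)` — the current gap never
exceeds the profile-weighted average of its window plus B's extra-age bonus (the form generation 53 asked for; `e` itself is NOT monotone for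
two-step memory, seat numerics of generation 53). [cite: Balaban1987RG1, (0.20) p.256 and Thm 2 p.259] -/
theorem windowAverage_twoStep
    (hβ : ∀ (k : ℕ) (p : Fin (k + 1) → ℝ),
      β k p = b + ∑ i : Fin (k + 1), ρ (k - i) * min (p (Fin.last k)) (|p (Fin.last k) - p i|))
    (hb : 0 < b) (hρ0 : ∀ a, 0 ≤ ρ a) (hρW : ∀ n, ∑ a ∈ range n, ρ a ≤ W) (hρ2 : ∀ a, 3 ≤ a → ρ a = 0) (hρ12 : ρ 2 ≤ ρ 1)
    (hWγ : W * γ ≤ b) {K n : ℕ} {gA gB : ℕ → ℝ} (hA : RGEqH K β gA) (hB : RGEqH (K + n) β gB)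
    (hAbox : ∀ k, k ≤ K → 0 < gA k ∧ gA k ≤ γ) (hBpos : ∀ k, k ≤ K + n → 0 < gB k) (hpin : gA K = gB (K + n)) {j : ℕ}
    (hj : j < K) :
    0 ≤ (∑ i ∈ range n, ρ (j + n - i) * (gB (j + n) - gB i))
        + ∑ i ∈ range (j + 1), ρ (j - i) * ((gA i - gB (i + n)) - (gA j - gB (j + n))) := by
  have hApos : ∀ k, k ≤ K → 0 < gA k := fun k hk => (hAbox k hk).1
  rw [← disc_step_window hβ hb hρ0 hA hB hApos hBpos hj]
  linarith [disc_succ_le_disc_twoStep hβ hb hρ0 hρW hρ2 hρ12 hWγ hA hB hAbox hBpos hpin j hj]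

/-! ## §4 Pinned family with two-step memory: the continuum correction grows towards the ultraviolet end of every run -/

/-- **FAMILY FORM, TWO-STEP MEMORY.**  A pinned family of runs (`g K` the run with `K` steps in ]0,γ], `g K K = g_IR`) of the family with
`ρ(a) = 0` for `a ≥ 3`, `ρ(2) ≤ ρ(1)`, `Σ_{a<N} ρ(a) ≤ W`, `Wγ ≤ b`: for all `m, j, n`,
`invSq g m (j+1+n) − invSq g m (j+1) ≤ invSq g (m+1) (j+n) − invSq g (m+1) j` (runs of lengths `j+1+m` and `j+1+m+n`; `disc_succ_le_disc_twoStep`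
BY NAME). [cite: Balaban1987RG1, (0.20) p.256, (0.31) and Thm 2 p.259] -/
theorem invSq_shift_mono_position_twoStep
    (hβ : ∀ (k : ℕ) (p : Fin (k + 1) → ℝ),
      β k p = b + ∑ i : Fin (k + 1), ρ (k - i) * min (p (Fin.last k)) (|p (Fin.last k) - p i|))
    (hb : 0 < b) (hρ0 : ∀ a, 0 ≤ ρ a) (hρW : ∀ n, ∑ a ∈ range n, ρ a ≤ W) (hρ2 : ∀ a, 3 ≤ a → ρ a = 0) (hρ12 : ρ 2 ≤ ρ 1)
    (hWγ : W * γ ≤ b) {g : ℕ → ℕ → ℝ} {gIR : ℝ} (hrun : ∀ K, RGEqH K β (g K)) (hbox : ∀ K i, i ≤ K → 0 < g K i ∧ g K i ≤ γ)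
    (hpin : ∀ K, g K K = gIR) (m j n : ℕ) :
    invSq g m (j + 1 + n) - invSq g m (j + 1) ≤ invSq g (m + 1) (j + n) - invSq g (m + 1) j := by
  have hA : RGEqH (j + 1 + m) β (g (j + 1 + m)) := hrun _
  have hB : RGEqH (j + 1 + m + n) β (g (j + 1 + m + n)) := hrun _
  have hpin' : g (j + 1 + m) (j + 1 + m) = g (j + 1 + m + n) (j + 1 + m + n) := by rw [hpin, hpin]
  have h := disc_succ_le_disc_twoStep hβ hb hρ0 hρW hρ2 hρ12 hWγ hA hB (fun k hk => hbox _ k hk) (fun k hk => (hbox _ k hk).1)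
    hpin' j (by omega)
  have e1 : invSq g m (j + 1 + n) = 1 / (g (j + 1 + m + n) (j + 1 + n)) ^ 2 := by
    rw [invSq_def, show j + 1 + n + m = j + 1 + m + n by omega]
  have e2 : invSq g m (j + 1) = 1 / (g (j + 1 + m) (j + 1)) ^ 2 := by rw [invSq_def]
  have e3 : invSq g (m + 1) (j + n) = 1 / (g (j + 1 + m + n) (j + n)) ^ 2 := by
    rw [invSq_def, show j + n + (m + 1) = j + 1 + m + n by omega]
  have e4 : invSq g (m + 1) j = 1 / (g (j + 1 + m) j) ^ 2 := by
    rw [invSq_def, show j + (m + 1) = j + 1 + m by omega]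
  rw [e1, e2, e3, e4]
  exact h

/-- **THE CONTINUUM CORRECTION GROWS TOWARDS THE ULTRAVIOLET END OF A RUN, TWO-STEP MEMORY** (`γ > 0`).  Same family:
`astar g m − invSq g m (j+1) ≤ astar g (m+1) − invSq g (m+1) j` for all `m, j` (`n → ∞` in `invSq_shift_mono_position_twoStep`, by generation
47's `continuum_monotone`). [cite: Balaban1987RG1, (0.20) p.256, (0.31) and Thm 2 p.259] -/
theorem astar_sub_invSq_mono_position_twoStep
    (hβ : ∀ (k : ℕ) (p : Fin (k + 1) → ℝ),
      β k p = b + ∑ i : Fin (k + 1), ρ (k - i) * min (p (Fin.last k)) (|p (Fin.last k) - p i|))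
    (hb : 0 < b) (hγ : 0 < γ) (hρ0 : ∀ a, 0 ≤ ρ a) (hρW : ∀ n, ∑ a ∈ range n, ρ a ≤ W) (hρ2 : ∀ a, 3 ≤ a → ρ a = 0)
    (hρ12 : ρ 2 ≤ ρ 1) (hWγ : W * γ ≤ b) {g : ℕ → ℕ → ℝ} {gIR : ℝ} (hrun : ∀ K, RGEqH K β (g K))
    (hbox : ∀ K i, i ≤ K → 0 < g K i ∧ g K i ≤ γ) (hpin : ∀ K, g K K = gIR) (m j : ℕ) :
    astar g m - invSq g m (j + 1) ≤ astar g (m + 1) - invSq g (m + 1) j := by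
  have hlim := (continuum_monotone hβ hb hγ hρ0 hρW hrun hbox hpin).1
  have h1 : Tendsto (fun n => invSq g m (j + 1 + n) - invSq g m (j + 1)) atTop (𝓝 (astar g m - invSq g m (j + 1))) :=
    ((hlim m).comp (tendsto_atTop_atTop_of_monotone (fun a b hab => by omega) fun n => ⟨n, by omega⟩)).sub
      tendsto_const_nhds
  have h2 : Tendsto (fun n => invSq g (m + 1) (j + n) - invSq g (m + 1) j) atTop
      (𝓝 (astar g (m + 1) - invSq g (m + 1) j)) :=
    ((hlim (m + 1)).comp (tendsto_atTop_atTop_of_monotone (fun a b hab => by omega) fun n => ⟨n, by omega⟩)).sub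
      tendsto_const_nhds
  exact le_of_tendsto_of_tendsto' h1 h2 fun n =>
    invSq_shift_mono_position_twoStep hβ hb hρ0 hρW hρ2 hρ12 hWγ hrun hbox hpin m j n

/-- TELESCOPED IN THE INFRARED DISTANCE, TWO-STEP MEMORY: `astar g m − invSq g m (j+t) ≤ astar g (m+t) − invSq g (m+t) j` for all `m, j, t`.
[cite: Balaban1987RG1, (0.20) p.256, (0.31) and Thm 2 p.259] -/
theorem astar_sub_invSq_mono_position_twoStep_le
    (hβ : ∀ (k : ℕ) (p : Fin (k + 1) → ℝ),
      β k p = b + ∑ i : Fin (k + 1), ρ (k - i) * min (p (Fin.last k)) (|p (Fin.last k) - p i|))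
    (hb : 0 < b) (hγ : 0 < γ) (hρ0 : ∀ a, 0 ≤ ρ a) (hρW : ∀ n, ∑ a ∈ range n, ρ a ≤ W) (hρ2 : ∀ a, 3 ≤ a → ρ a = 0)
    (hρ12 : ρ 2 ≤ ρ 1) (hWγ : W * γ ≤ b) {g : ℕ → ℕ → ℝ} {gIR : ℝ} (hrun : ∀ K, RGEqH K β (g K))
    (hbox : ∀ K i, i ≤ K → 0 < g K i ∧ g K i ≤ γ) (hpin : ∀ K, g K K = gIR) (m j t : ℕ) :
    astar g m - invSq g m (j + t) ≤ astar g (m + t) - invSq g (m + t) j := by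
  induction t generalizing m j with
  | zero => simp
  | succ t ih =>
    have h1 := astar_sub_invSq_mono_position_twoStep hβ hb hγ hρ0 hρW hρ2 hρ12 hWγ hrun hbox hpin m (j + t)
    have h2 := ih (m + 1) j
    rw [show j + (t + 1) = j + t + 1 by omega, show m + (t + 1) = m + 1 + t by omega]
    linarith

end Summit.QuantumFields.BalabanUV.Beta.RemainderExplicitHistoryDiagonalTwoStepMonotone
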